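import Summits.HubbardSuperconductivity.HubbardSuperconductivity.Theorems.AnisotropyChordTransferFibre3FinX3SoundC
import Summits.HubbardSuperconductivity.HubbardSuperconductivity.Theorems.AnisotropyChordTransferFibre3FinX3SoundD
import Summits.HubbardSuperconductivity.HubbardSuperconductivity.Theorems.AnisotropyChordTransferFibre3FinX3SoundS
import Summits.HubbardSuperconductivity.HubbardSuperconductivity.Theorems.AnisotropyChordTransferFibre3FinX3SoundB
import Summits.HubbardSuperconductivity.HubbardSuperconductivity.Theorems.AnisotropyChordTransferFibre3FinXDGM3

/-!
# Route `AnisotropyChord` / H0 rotor rung: FIN per-`L` GM₃ (X3, `L ≥ 25`) — ★★★ `gm3_of_gmCheck3`: GM₃ at this `L` from the X3 cell facts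

The X3 analogue of g7's `…FinXDGM3.gm3_of_gmCheck` / `…FinXDGM3b.gm3_of_gmCheck2`: a passing `gmCheck3 L Δ₁ bd cells` (every
consecutive pair of the `GCell3` list passes `gmCellOK3` = the combined rows-`N₁`+C fact exporting the `T⁺ − 3λ₂` bracket `nt`, the
row-D fact and the side-condition fact reading `nt`, all on the SAME λ-cell) gives `GM3Fibre L Δ` for every `0 < Δ ≤ Δ₁`, `Δ < 1`
(`9 ≤ L`): chunking lemma `cellsAllG3_cons_append`, arithmetic cover `cover_allG3`, ★ `gm3_of_gmCellOK3` (the three cruxes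
`TrialGapAbs c`, `LowShellGFormAbs aD`, `OffPoleTailAbs (bn/bd)` at `Δ` by ground uniqueness, then `gm3_closedRho_twoHoleGap` with
HOLE₂(¾) `Hole2.twoHoleGap_threeQuarter`), ★★★ `gm3_of_gmCheck3`; and the same for the SPLIT form (rows `N₁` and C as separate
facts, the row-`N₁` fact exporting the `T⁺·D` brackets read by the row-C fact): `cellsAllG4_cons_append`, `cover_allG4`,
★ `gm3_of_gmCellOK4`, ★★★ `gm3_of_gmCheck4`.
Prover seat `hubbard-h0-rotor-p3` g8; helper for piece A = stmt-HubbardSuperconductivity-23918 of rung 19089 (`--supports`, helper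
class).  WHAT THIS IS NOT: nothing here proves superconductivity in the Hubbard model (rotor TARGET as worded stays FALSE, g15 verdict);
the per-`L` GM₃ input of ONE conditional reduction from kernel cell facts.  Tree imports only; no sorry, no new axioms.
-/

set_option linter.dupNamespace false
set_option autoImplicit false

namespace Summit.HubbardSuperconductivity.HubbardSuperconductivity.Theorems.AnisotropyChord.Transfer.Fibre3

namespace FinXD

open scoped BigOperators
open Finset Hole2 FinCell FinXB

/-- chunking lemma for long certificate lists: `cellsAllG3` of `x :: (xs ++ y :: ys)` from `x :: (xs ++ [y])` and `y :: ys`. [folklore] -/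
theorem cellsAllG3_cons_append (L : ℕ) (d1 : ℚ) (bd : ℕ) {x y : GCell3} {xs ys : List GCell3}
    (h1 : cellsAllG3 L d1 bd (x :: (xs ++ [y])) = true) (h2 : cellsAllG3 L d1 bd (y :: ys) = true) :
    cellsAllG3 L d1 bd (x :: (xs ++ y :: ys)) = true := by
  induction xs generalizing x with
  | nil =>
    simp only [List.nil_append, cellsAllG3, Bool.and_eq_true] at h1 ⊢
    exact ⟨h1.1, h2⟩
  | cons z zs ih =>
    simp only [List.cons_append, cellsAllG3, Bool.and_eq_true] at h1 ⊢
    exact ⟨h1.1, ih h1.2⟩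

/-- the arithmetic cover: a point of `[p₀, last]` lies in some checked pair. [folklore] -/
theorem cover_allG3 (L : ℕ) (d1 : ℚ) (bd : ℕ) : ∀ (rest : List GCell3) (a b : GCell3) (x : ℝ),
    cellsAllG3 L d1 bd (a :: b :: rest) = true → (a.lam : ℝ) ≤ x → x ≤ ((cellsLastG3 (a :: b :: rest) : ℤ) : ℝ) →
    ∃ g : GCell3, ∃ nx : ℤ, gmCellOK3 L d1 bd g nx = true ∧ (g.lam : ℝ) ≤ x ∧ x ≤ (nx : ℝ) := by
  intro rest
  induction rest with
  | nil =>
    intro a b x h hax hxl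
    simp only [cellsAllG3, Bool.and_true] at h
    exact ⟨a, b.lam, h, hax, by simpa [cellsLastG3] using hxl⟩
  | cons c rest ih =>
    intro a b x h hax hxl
    rw [show cellsAllG3 L d1 bd (a :: b :: c :: rest) = (gmCellOK3 L d1 bd a b.lam && cellsAllG3 L d1 bd (b :: c :: rest)) from rfl,
      Bool.and_eq_true] at h
    obtain ⟨h1, h2⟩ := h
    by_cases hxb : x ≤ (b.lam : ℝ)
    · exact ⟨a, b.lam, h1, hax, hxb⟩
    · have hbx : (b.lam : ℝ) ≤ x := le_of_lt (lt_of_not_ge hxb)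
      have hl : cellsLastG3 (a :: b :: c :: rest) = cellsLastG3 (b :: c :: rest) := rfl
      rw [hl] at hxl
      exact ih b c x h2 hbx hxl

/-- ★ one GM₃ pair (X3): the ground profile with `λ₂·D ∈ [g.lam, nx]` yields `GM3Fibre L Δ` (`9 ≤ L`, `0 < Δ ≤ Δ₁ < 1`). [folklore] -/
theorem gm3_of_gmCellOK3 (L : ℕ) [NeZero L] (hL : 9 ≤ L) {d1 : ℚ} {bd : ℕ} (hbd : 0 < bd) {Δ lam2 : ℝ}
    (hΔ0 : 0 < Δ) (hΔd : Δ ≤ (d1 : ℝ)) (hΔ1 : Δ < 1) {f : Tor L → ℝ} (hf : IsGroundTwoMagnon L Δ lam2 f)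
    {g : GCell3} {nx : ℤ} (hok : gmCellOK3 L d1 bd g nx = true)
    (hlo : (g.lam : ℝ) ≤ lam2 * ((D : ℤ) : ℝ)) (hhi : lam2 * ((D : ℤ) : ℝ) ≤ (nx : ℝ)) : GM3Fibre L Δ := by
  have hL5 : 5 ≤ L := by omega
  unfold gmCellOK3 at hok
  simp only [Bool.and_eq_true] at hok
  obtain ⟨⟨hC, hD'⟩, hS⟩ := hok
  -- the combined cell: rows `N₁` + C and the `T⁺ − 3λ₂` bracket
  obtain ⟨hCC, hnt⟩ := xbcn_cellAny_sound L hL5 hΔ0 hΔd hΔ1 hf hlo hhi hC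
  -- row D and the side condition read the bracket
  have hrowD := xdN_cellAny_sound L hL hΔ0 hΔd hΔ1 hf hlo hhi hnt hD'
  obtain ⟨hm, hside⟩ := sdzN_cellAny_sound L hL5 hΔ0 hΔd hΔ1 hf hlo hhi hnt hS
  -- every ground profile at `Δ` is this one
  have huniq : ∀ lam2' : ℝ, ∀ f' : Tor L → ℝ, IsGroundTwoMagnon L Δ lam2' f' → lam2' = lam2 ∧ f' = f := by
    intro lam2' f' hf'
    have hl : lam2' = lam2 := ground_lam2_unique L (by omega) hf' hf
    subst hl
    exact ⟨rfl, by rw [ground_eq_explicit L hL5 hΔ0.le hΔ1 hf', ground_eq_explicit L hL5 hΔ0.le hΔ1 hf]⟩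
  have hKT1 : TrialGapAbs L Δ g.c := by
    intro lam2' f' hf'
    obtain ⟨rfl, rfl⟩ := huniq lam2' f' hf'
    exact hCC.1
  have hKT2a : LowShellGFormAbs L Δ g.aD := by
    intro lam2' f' hf'
    obtain ⟨rfl, rfl⟩ := huniq lam2' f' hf'
    exact hrowD
  have hbdR : (0 : ℝ) < bd := by exact_mod_cast hbd
  have hKT2b : OffPoleTailAbs L Δ ((g.bn : ℝ) / bd) := by
    refine KT2Assembly.offPoleTailAbs_of_brackets L (by omega) hΔ1 (by positivity) ?_
    intro lam2' f' hf'
    obtain ⟨rfl, rfl⟩ := huniq lam2' f' hf'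
    exact hCC.2
  have hT2 := Tplus_lt_of_mHole_nonneg L (by omega) hm
  have hside' : facMI L Δ f * etaEff L lam2 * ((g.aD : ℝ) + ((g.bn : ℝ) / bd) / (2 + Real.cos (2 * Real.pi / L))) < (g.c : ℝ) := by
    simpa using hside
  exact gm3_closedRho_twoHoleGap L (by omega) hΔ0 hΔ1 (g.c : ℝ) (g.aD : ℝ) ((g.bn : ℝ) / bd)
    (Hole2.twoHoleGap_threeQuarter L hL) hf hT2 hm hside' hKT1 hKT2a hKT2b

/-- ★★★ **GM₃ AT THIS `L` FROM THE X3 KERNEL CELL FACTS**: `gmCheck3 L Δ₁ bd cells = true` (`9 ≤ L`) ⟹ `GM3Fibre L Δ` for every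
`0 < Δ ≤ Δ₁`, `Δ < 1`. -/
theorem gm3_of_gmCheck3 (L : ℕ) [NeZero L] (hL : 9 ≤ L) {d1 : ℚ} {bd : ℕ} {cells : List GCell3}
    (h : gmCheck3 L d1 bd cells = true) {Δ : ℝ} (hΔ0 : 0 < Δ) (hΔd : Δ ≤ (d1 : ℝ)) (hΔ1 : Δ < 1) : GM3Fibre L Δ := by
  obtain ⟨lam2, f, hf⟩ := exists_ground L (by omega) Δ
  have hD := D_pos
  unfold gmCheck3 at h
  simp only [Bool.and_eq_true, decide_eq_true_eq] at h
  obtain ⟨⟨⟨⟨hhead, hlen⟩, htop⟩, hbd⟩, hok⟩ := h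
  obtain ⟨a, b, rest, hcells⟩ : ∃ a b : GCell3, ∃ rest : List GCell3, cells = a :: b :: rest := by
    match cells, hlen with
    | a :: b :: rest, _ => exact ⟨a, b, rest, rfl⟩
  subst hcells
  have ha0 : a.lam = 0 := by simpa using hhead
  have hwin := forall_ground_of_window_7 L (by omega) hΔ0.le hΔ1
    (fun lam2' (f' : Tor L → ℝ) => lam2' = lam2 → GM3Fibre L Δ) ?_
  · exact hwin lam2 f hf rfl
  intro lam2' f' hf' hlam0 hlamle hEq
  subst hEq
  set x : ℝ := lam2' * ((D : ℤ) : ℝ) with hx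
  have hx0 : (a.lam : ℝ) ≤ x := by rw [ha0, hx]; push_cast; positivity
  have hxtop : x ≤ ((cellsLastG3 (a :: b :: rest) : ℤ) : ℝ) :=
    (lam_mul_D_le_lamTop L (by omega) hlamle).trans (by exact_mod_cast htop)
  obtain ⟨g, nx, hcell, hgx, hxn⟩ := cover_allG3 L d1 bd rest a b x hok hx0 hxtop
  exact gm3_of_gmCellOK3 L hL hbd hΔ0 hΔd hΔ1 hf' hcell hgx hxn

/-! ## The split form (X4) -/

/-- chunking lemma (split form). [folklore] -/
theorem cellsAllG4_cons_append (L : ℕ) (d1 : ℚ) (bd : ℕ) {x y : GCell4} {xs ys : List GCell4}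
    (h1 : cellsAllG4 L d1 bd (x :: (xs ++ [y])) = true) (h2 : cellsAllG4 L d1 bd (y :: ys) = true) :
    cellsAllG4 L d1 bd (x :: (xs ++ y :: ys)) = true := by
  induction xs generalizing x with
  | nil =>
    simp only [List.nil_append, cellsAllG4, Bool.and_eq_true] at h1 ⊢
    exact ⟨h1.1, h2⟩
  | cons z zs ih =>
    simp only [List.cons_append, cellsAllG4, Bool.and_eq_true] at h1 ⊢
    exact ⟨h1.1, ih h1.2⟩

/-- the arithmetic cover (split form). [folklore] -/
theorem cover_allG4 (L : ℕ) (d1 : ℚ) (bd : ℕ) : ∀ (rest : List GCell4) (a b : GCell4) (x : ℝ),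
    cellsAllG4 L d1 bd (a :: b :: rest) = true → (a.lam : ℝ) ≤ x → x ≤ ((cellsLastG4 (a :: b :: rest) : ℤ) : ℝ) →
    ∃ g : GCell4, ∃ nx : ℤ, gmCellOK4 L d1 bd g nx = true ∧ (g.lam : ℝ) ≤ x ∧ x ≤ (nx : ℝ) := by
  intro rest
  induction rest with
  | nil =>
    intro a b x h hax hxl
    simp only [cellsAllG4, Bool.and_true] at h
    exact ⟨a, b.lam, h, hax, by simpa [cellsLastG4] using hxl⟩
  | cons c rest ih =>
    intro a b x h hax hxl
    rw [show cellsAllG4 L d1 bd (a :: b :: c :: rest) = (gmCellOK4 L d1 bd a b.lam && cellsAllG4 L d1 bd (b :: c :: rest)) from rfl,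
      Bool.and_eq_true] at h
    obtain ⟨h1, h2⟩ := h
    by_cases hxb : x ≤ (b.lam : ℝ)
    · exact ⟨a, b.lam, h1, hax, hxb⟩
    · have hbx : (b.lam : ℝ) ≤ x := le_of_lt (lt_of_not_ge hxb)
      have hl : cellsLastG4 (a :: b :: c :: rest) = cellsLastG4 (b :: c :: rest) := rfl
      rw [hl] at hxl
      exact ih b c x h2 hbx hxl

/-- ★ one GM₃ pair (X4 split form): the ground profile with `λ₂·D ∈ [g.lam, nx]` yields `GM3Fibre L Δ` (`9 ≤ L`, `0 < Δ ≤ Δ₁ < 1`). [folklore] -/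
theorem gm3_of_gmCellOK4 (L : ℕ) [NeZero L] (hL : 9 ≤ L) {d1 : ℚ} {bd : ℕ} (hbd : 0 < bd) {Δ lam2 : ℝ}
    (hΔ0 : 0 < Δ) (hΔd : Δ ≤ (d1 : ℝ)) (hΔ1 : Δ < 1) {f : Tor L → ℝ} (hf : IsGroundTwoMagnon L Δ lam2 f)
    {g : GCell4} {nx : ℤ} (hok : gmCellOK4 L d1 bd g nx = true)
    (hlo : (g.lam : ℝ) ≤ lam2 * ((D : ℤ) : ℝ)) (hhi : lam2 * ((D : ℤ) : ℝ) ≤ (nx : ℝ)) : GM3Fibre L Δ := by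
  have hL5 : 5 ≤ L := by omega
  unfold gmCellOK4 at hok
  simp only [Bool.and_eq_true] at hok
  obtain ⟨⟨⟨hN, hC⟩, hD'⟩, hS⟩ := hok
  -- row `N₁` with the two exports
  obtain ⟨hN1, hnt, hTlo, hThi⟩ := xbn_cellAny_sound L hL5 hΔ0 hΔd hΔ1 hf hlo hhi hN
  -- row C reads the `T⁺` brackets; row D and the side condition read `nt`
  have hCC := xc_cellAny_sound L hL5 hΔ0 hΔd hΔ1 hf hlo hhi hTlo hThi hC
  have hrowD := xdN_cellAny_sound L hL hΔ0 hΔd hΔ1 hf hlo hhi hnt hD'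
  obtain ⟨hm, hside⟩ := sdzN_cellAny_sound L hL5 hΔ0 hΔd hΔ1 hf hlo hhi hnt hS
  have huniq : ∀ lam2' : ℝ, ∀ f' : Tor L → ℝ, IsGroundTwoMagnon L Δ lam2' f' → lam2' = lam2 ∧ f' = f := by
    intro lam2' f' hf'
    have hl : lam2' = lam2 := ground_lam2_unique L (by omega) hf' hf
    subst hl
    exact ⟨rfl, by rw [ground_eq_explicit L hL5 hΔ0.le hΔ1 hf', ground_eq_explicit L hL5 hΔ0.le hΔ1 hf]⟩
  have hKT1 : TrialGapAbs L Δ g.c := by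
    intro lam2' f' hf'
    obtain ⟨rfl, rfl⟩ := huniq lam2' f' hf'
    exact hN1
  have hKT2a : LowShellGFormAbs L Δ g.aD := by
    intro lam2' f' hf'
    obtain ⟨rfl, rfl⟩ := huniq lam2' f' hf'
    exact hrowD
  have hbdR : (0 : ℝ) < bd := by exact_mod_cast hbd
  have hKT2b : OffPoleTailAbs L Δ ((g.bn : ℝ) / bd) := by
    refine KT2Assembly.offPoleTailAbs_of_brackets L (by omega) hΔ1 (by positivity) ?_
    intro lam2' f' hf'
    obtain ⟨rfl, rfl⟩ := huniq lam2' f' hf'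
    exact hCC
  have hT2 := Tplus_lt_of_mHole_nonneg L (by omega) hm
  have hside' : facMI L Δ f * etaEff L lam2 * ((g.aD : ℝ) + ((g.bn : ℝ) / bd) / (2 + Real.cos (2 * Real.pi / L))) < (g.c : ℝ) := by
    simpa using hside
  exact gm3_closedRho_twoHoleGap L (by omega) hΔ0 hΔ1 (g.c : ℝ) (g.aD : ℝ) ((g.bn : ℝ) / bd)
    (Hole2.twoHoleGap_threeQuarter L hL) hf hT2 hm hside' hKT1 hKT2a hKT2b

/-- ★★★ **GM₃ AT THIS `L` FROM THE X4 KERNEL CELL FACTS (split form)**: `gmCheck4 L Δ₁ bd cells = true` (`9 ≤ L`) ⟹ `GM3Fibre L Δ`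
for every `0 < Δ ≤ Δ₁`, `Δ < 1`. -/
theorem gm3_of_gmCheck4 (L : ℕ) [NeZero L] (hL : 9 ≤ L) {d1 : ℚ} {bd : ℕ} {cells : List GCell4}
    (h : gmCheck4 L d1 bd cells = true) {Δ : ℝ} (hΔ0 : 0 < Δ) (hΔd : Δ ≤ (d1 : ℝ)) (hΔ1 : Δ < 1) : GM3Fibre L Δ := by
  obtain ⟨lam2, f, hf⟩ := exists_ground L (by omega) Δ
  have hD := D_pos
  unfold gmCheck4 at h
  simp only [Bool.and_eq_true, decide_eq_true_eq] at h
  obtain ⟨⟨⟨⟨hhead, hlen⟩, htop⟩, hbd⟩, hok⟩ := h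
  obtain ⟨a, b, rest, hcells⟩ : ∃ a b : GCell4, ∃ rest : List GCell4, cells = a :: b :: rest := by
    match cells, hlen with
    | a :: b :: rest, _ => exact ⟨a, b, rest, rfl⟩
  subst hcells
  have ha0 : a.lam = 0 := by simpa using hhead
  have hwin := forall_ground_of_window_7 L (by omega) hΔ0.le hΔ1
    (fun lam2' (f' : Tor L → ℝ) => lam2' = lam2 → GM3Fibre L Δ) ?_
  · exact hwin lam2 f hf rfl
  intro lam2' f' hf' hlam0 hlamle hEq
  subst hEq
  set x : ℝ := lam2' * ((D : ℤ) : ℝ) with hx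
  have hx0 : (a.lam : ℝ) ≤ x := by rw [ha0, hx]; push_cast; positivity
  have hxtop : x ≤ ((cellsLastG4 (a :: b :: rest) : ℤ) : ℝ) :=
    (lam_mul_D_le_lamTop L (by omega) hlamle).trans (by exact_mod_cast htop)
  obtain ⟨g, nx, hcell, hgx, hxn⟩ := cover_allG4 L d1 bd rest a b x hok hx0 hxtop
  exact gm3_of_gmCellOK4 L hL hbd hΔ0 hΔd hΔ1 hf' hcell hgx hxn

end FinXD

end Summit.HubbardSuperconductivity.HubbardSuperconductivity.Theorems.AnisotropyChord.Transfer.Fibre3
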